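import Summits.Ventures.PercRepro.RankLevelSetBiIndepProfileAll

/-! # RankLevelSetFullFamilyTightest — «THE FULL FAMILY IS THE TIGHTEST» (FT) AND THE REDUCTION OF THE LEVEL-WISE FORM
AT THE TIGHT LAYER TO (FT) + THE BI-INDEPENDENT ULC (night-1 g23, attempt 2; dossier §35.11)

For a level `q < t < p` and a family `𝒜` of members write `N_t(𝒜)` for the rank-`t` UP-neighbours of `𝒜`. (FT) says
that the ratio `#N_t(𝒜)/#𝒜` is minimised by the full family `𝒵 = cellMembers`: `#N_t(𝒵)·#𝒜 ≤ #N_t(𝒜)·#𝒵` for every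
nonempty `𝒜 ⊆ 𝒵`. Evidence: every matroid on ≤ 9 elements at the tight layer, every level (12 + 37 + 90 + 468 + 2,774
`(M,t)` instances; the exact Hall room by Dinkelbach iteration, mining/night-1/g23/hallroom.py, kit j299165): (FT) holds
in every instance, while its analogue for the independent-set form fails in 37 of them — the fat sets make the full
family extremal. With the global inequality of `RankLevelSetBiIndepProfileAll` (conditional on the Lorentzian fact
`BiIndepULC M`), (FT) gives the level-wise form for EVERY subfamily: the reduction proved below. Every declaration has
a docstring; imports: the cell's own modules and Mathlib only. -/

namespace PercRepro

open Set Matroid Finset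

variable {α : Type} (M : Matroid α) [M.Finite]

omit [M.Finite] in
/-- **(FT) at the level `t` of the cell `(p, q)`** (a `Prop`, NOT asserted): for every nonempty subfamily `𝒜` of
members, `#N_t(𝒵)·#𝒜 ≤ #N_t(𝒜)·#𝒵` — the full family has the smallest neighbourhood-to-size ratio. -/
def FullFamilyTightest (p q t : ℕ) : Prop :=
  ∀ 𝒜 ⊆ cellMembers M p q, 𝒜.Nonempty →
    ({S ∈ upNbhd M p q (cellMembers M p q) | M.eRk S = (t : ℕ∞)}.ncard : ℚ) * (𝒜.ncard : ℚ) ≤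
      ({S ∈ upNbhd M p q 𝒜 | M.eRk S = (t : ℕ∞)}.ncard : ℚ) * ((cellMembers M p q).ncard : ℚ)

/-- **THE REDUCTION**: at the tight layer `#E = p + q`, for `q < t < p`, the bi-independent ULC (the global inequality)
together with (FT) at the level `t` gives the level-wise inequality `C(p+q,t)·#𝒜 ≤ C(p+q,q)·#N_t(𝒜)` for EVERY
subfamily `𝒜` of members — the inequality of `LevelHallUpC025` at that level. -/
theorem levelHallUp_of_fullFamilyTightest (hULC : BiIndepULC M) {p q t : ℕ} (hE : M.E.ncard = p + q)
    (hqt : q < t) (htp : t < p) (hFT : FullFamilyTightest M p q t)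
    (𝒜 : Set (Set α)) (h𝒜 : 𝒜 ⊆ cellMembers M p q) :
    ((p + q).choose t : ℚ) * (𝒜.ncard : ℚ) ≤
      ((p + q).choose q : ℚ) * ({S ∈ upNbhd M p q 𝒜 | M.eRk S = (t : ℕ∞)}.ncard : ℚ) := by
  by_cases hne : 𝒜.Nonempty
  · have hglob := levelHallUp_members_rank_of_biIndepULC_all M hULC hE hqt htp
    have hft := hFT 𝒜 h𝒜 hne
    have hZfin : (cellMembers M p q).Finite := M.ground_finite.finite_subsets.subset (fun _ h => h.1)
    have hZpos : (0 : ℚ) < ((cellMembers M p q).ncard : ℚ) := by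
      have : 0 < (cellMembers M p q).ncard :=
        (Set.ncard_pos hZfin).mpr (hne.mono h𝒜)
      exact_mod_cast this
    have hApos : (0 : ℚ) ≤ (𝒜.ncard : ℚ) := by positivity
    have hCq : (0 : ℚ) ≤ ((p + q).choose q : ℚ) := by positivity
    -- C(n,t)·#𝒜·#𝒵 ≤ C(n,q)·#N(𝒵)·#𝒜 ≤ C(n,q)·#N(𝒜)·#𝒵
    have h1 : ((p + q).choose t : ℚ) * (𝒜.ncard : ℚ) * ((cellMembers M p q).ncard : ℚ) ≤
        ((p + q).choose q : ℚ) * ({S ∈ upNbhd M p q 𝒜 | M.eRk S = (t : ℕ∞)}.ncard : ℚ) *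
          ((cellMembers M p q).ncard : ℚ) := by
      calc ((p + q).choose t : ℚ) * (𝒜.ncard : ℚ) * ((cellMembers M p q).ncard : ℚ)
          = (((p + q).choose t : ℚ) * ((cellMembers M p q).ncard : ℚ)) * (𝒜.ncard : ℚ) := by ring
        _ ≤ (((p + q).choose q : ℚ) *
              ({S ∈ upNbhd M p q (cellMembers M p q) | M.eRk S = (t : ℕ∞)}.ncard : ℚ)) * (𝒜.ncard : ℚ) :=
            mul_le_mul_of_nonneg_right hglob hApos
        _ = ((p + q).choose q : ℚ) *
              (({S ∈ upNbhd M p q (cellMembers M p q) | M.eRk S = (t : ℕ∞)}.ncard : ℚ) * (𝒜.ncard : ℚ)) := by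
            ring
        _ ≤ ((p + q).choose q : ℚ) *
              (({S ∈ upNbhd M p q 𝒜 | M.eRk S = (t : ℕ∞)}.ncard : ℚ) * ((cellMembers M p q).ncard : ℚ)) :=
            mul_le_mul_of_nonneg_left hft hCq
        _ = ((p + q).choose q : ℚ) * ({S ∈ upNbhd M p q 𝒜 | M.eRk S = (t : ℕ∞)}.ncard : ℚ) *
              ((cellMembers M p q).ncard : ℚ) := by ring
    exact le_of_mul_le_mul_right h1 hZpos
  · rw [Set.not_nonempty_iff_eq_empty] at hne
    rw [hne, Set.ncard_empty]
    simp only [Nat.cast_zero, mul_zero]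
    positivity

/-! ## RETRACTION OF THE CONJECTURE (night-1 g23, attempt 2, 05:1xZ; dossier §35.11⁗; RankLevelSetFullFamilyTightestModelNeg)

`FullFamilyTightest` is FALSE for some matroids: on the model family `T_{q+k}(U_{q,F} ⊕ free D)` at
`(q,k,m,s) = (10,2,7,1)` (`n = 22`, the cell `(12,10)`, the first level `t = 11`) the members with 2 or 3 elements in `D`
have neighbourhood-to-size ratio `4/3`, below the full family's `789570/578578 = 1.3647…` (the arithmetic witness is
`fullFamilyTightest_false_model_10_2_7_1`; an exact type max-flow confirms). The evidence quoted above (every matroid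
on ≤ 9 elements) is true as stated but too small to see the fat-flat regime `q ≥ 10`, `m ≥ 7`. The implication
`levelHallUp_of_fullFamilyTightest` is correct; it is NOT a route to C-044: (FT) is strictly stronger than the level-wise
inequality and fails where the far members see only thin sets while the fat sets pad the full family. -/

end PercRepro
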